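import Summits.QuantumFields.BalabanUV.Beta.GAN24.EffectiveFormDecay

/-!
# `BalabanUV.Beta.GAN24.DiagramDecayAlgebra` — binder row G-an2-4 ∕ (CONV-C), route R7 «TWO CURRENCIES», PART 130: THE DIAGRAM ALGEBRA OF DECAYING RATE-TOWERS.
# The pair «level-uniform entry decay (UD) + King's two-level shape (SR)» — (CONV-C)'s two clauses for ONE constituent tower `c_k` on the unit lattice — is CLOSED,
# with VOLUME-FREE constants, under every operation a lattice Feynman diagram is built from: sums, scalars, transposes ∕ adjoints, PRODUCTS (an internal vertex summed
# over the lattice — one summability letter `S`), HADAMARD products (parallel lines between the same two vertices — decay rates ADD, no letter), KRONECKER products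
# (two lines as ONE kernel on the pair lattice, sum distance) — this file; dressing by VERTEX LEGS, diagonal parts (tadpoles), potentials and the weighted LOCAL
# FUNCTIONALS (the torus β-coefficient shadows, (AF-0r) shape) — PART 131.  (SR) alone gives the limit kernel with King's limit shape `DecayRate … (B′∕(1−θ)) δ θ`
# ((PR′) ⟹ (PR) at the matrix level).  Generic over finite index sets with «distances»; every constant free of the level and of the volume
# (unit b2b-balaban-gan24-p3, gen 53; v1)

NOT IN PRINT; OUR PROOF ([folklore] finite sums and the triangle inequality, BY NAME over the row owner's `DecayRateInterpolation` (`EntryDecay`, `DecayRate`, `TwoLevelDecayRate`,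
`entryDecay_sub`), PART 127 `UnitLatticeDecayAlgebra.entryDecay_mul` (the square case of §3), PART 128 `EffectiveFormDecay.entryDecay_of_le_rate`, and Mathlib's
`cauchySeq_of_le_geometric` ∕ `dist_le_of_le_geometric_of_tendsto`; method references only: the tree-decay bookkeeping of cluster expansions, e.g. [Rivasseau1991] §III.1, and
[King1986] Lemma 4.5 (4.38) p. 674 for the SHAPE; nothing printed is a hypothesis).
HONEST FRAMING (cell contract, verbatim): «discharging `BetaPertH` makes Bałaban's UV stability UNCONDITIONAL — a real constructive-QFT result; it is NOT the
continuum limit and NOT the Clay problem.»  HONEST DEPENDENCY (verbatim): «continuum YM on T⁴ ⇐ BetaPertH ∧ nine spine estimates (0/9 proved); BetaPertH ⇐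
(D1) ∧ (D4) ∧ CAP+tail; G-an2-4 gates asym, D1 and NE2/3/4.»

WHY THIS FILE.  The β-cell consumes (CONV-C) through `Beta.LimitRate.KernelInputs`: k-uniform decay (UD) and a one-step rate (PR′) `|Π⁰_{k+2}(x) − Π⁰_{k+1}(x)| ≤ C′θ^k e^{−δ′|x|}`
for the one-loop POLARIZATION kernel — a DIAGRAM, i.e. a finite contraction of propagator constituents with vertices — and then `|β⁰_{k+1} − β⁰_∞| ≤ c₀θ^k` by dominated
summation.  PARTs 115–129 deliver (UD)+(SR) with volume-free constants for the CONSTITUENTS (the u-derivative insertion chains, `Q_k𝒢Q_kᴴ`, its inverse, the effective form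
`Σ_k` and `Σ̇_k`) on every finite torus.  Between the two sits the «Table-T vertex contraction» (route R7, step S1): from the constituents' two clauses to the diagram's two
clauses.  THIS FILE is that step in the abstract — the vertices themselves (which diagrams Π⁰ is) are row an1's dictionary, not typed here; whatever they are, a finite
contraction of (UD)+(SR) towers through local or decaying vertices is again a (UD)+(SR) tower with constants built from the inputs' constants and the ONE letter `S`, free
of the level and of the volume.  PART 131 adds vertex legs, tadpoles and the local functionals; PART 132 instantiates both on the unit torus over the lineage's unconditional ENDs;
PART 133 is the `ℤ^d` socket to `KernelInputs`.

WHAT THIS FILE PROVES (0 sorry, 0 `def`, nothing cited; `n, m, l, p` finite index types, `dist : n → n → ℝ`; (UD) = `∀ k, EntryDecay dist (c k) B δ`; (SR) = `TwoLevelDecayRate dist c B′ δ θ`):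
* §1 `twoLevelDecayRate_iff_step` ((SR) IS (UD) of the steps with constant `B′θ^k` — definitional); `entryDecay_add ∕ _neg ∕ _transpose ∕ _conjTranspose`; (SR) under `+`, `−`, scalars,
  constants (`B′ = 0`), monotonicity in `B′` and in the rate, transpose ∕ adjoint; **`entryDecay_of_twoLevelDecayRate`** ((SR) + decay of `c_0` ⟹ (UD) with `B₀ + B′∕(1−θ)`).
* §2 LIMITS: `exists_limit_of_geometric_step` (scalars: `‖u_{k+1} − u_k‖ ≤ Cθ^k`, `θ < 1` ⟹ `u_k → u_∞`, `‖u_k − u_∞‖ ≤ Cθ^k∕(1−θ)` — the (AF-0r) SHAPE);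
  **`exists_limit_of_twoLevelDecayRate`** — (SR) with `θ < 1` ⟹ `∃ c_∞, c_k → c_∞ ∧ DecayRate dist c c_∞ (B′∕(1−θ)) δ θ` ((PR′) ⟹ (PR) at the matrix level).
* §3 PRODUCTS (internal vertex): **`norm_mul_apply_le_of_decay`** (RECTANGULAR kernels `l → m → p`, three «distances» with a mixed triangle inequality, one letter over the
  summed index — PART 127's `entryDecay_mul` is the square case); **`twoLevelDecayRate_mul`** — (UD)+(SR) for `c`, `c′` at rate `κ` ⟹ (SR) for `c_k·c′_k` with
  `((B₁′B₂ + B₁B₂′)·S, κ∕2, θ)` (telescoping + PART 127); `entryDecay_mul_tower`.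
* §4 HADAMARD products (parallel lines): **`entryDecay_hadamard`** (`(B₁B₂, δ₁ + δ₂)`, NO letter), **`twoLevelDecayRate_hadamard`**; the bubble `c_k ⊙ c_kᵀ` is §1 + §4.
* §5 KRONECKER products (the pair lattice `n × m`, sum distance): **`entryDecay_kronecker`**, **`twoLevelDecayRate_kronecker`**, the pair letter `sum_exp_pairDist_le` (`≤ S·S′`) and
  `pairDist_laws` (nonnegativity ∕ zero diagonal ∕ symmetry ∕ triangle) — so §3 and PART 127's Combes–Thomas step run on the pair lattice unchanged.
PART 131 (`DiagramDecayVertices`) continues with vertex dressing `Γ₁KΓ₂ᴴ`, diagonals ∕ potentials and the weighted LOCAL FUNCTIONALS (the torus β-coefficient shadows).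
WHAT IT DOES NOT DO: say WHICH diagram Bałaban's `Π⁰_{k+1}` is (row an1's vertex dictionary ∕ the Table-T vertices, `Q_k(U)`); infinite volume (the `ℤ^d` socket takes the volume-free
constants produced here as input); anything fine-level.  SUPPLIER work; no consumer of record; NEVER «G-an2-4 closed»; NOT (CONV-C), NOT D1, NOT `BetaPertH`, NOT continuum, NOT Clay.
Records: `HOME/b2b-balaban-gan24-p3/gen53/README.md`.
-/

noncomputable section

open scoped BigOperators ComplexConjugate Matrix Matrix.Norms.L2Operator Kronecker
open Filter Topology

namespace Summit.QuantumFields.BalabanUV.Beta.GAN24.DiagramDecayAlgebra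

open Summit.QuantumFields.BalabanUV.T4Continuum.DecayRateInterpolation (EntryDecay DecayRate TwoLevelDecayRate entryDecay_sub)
open Summit.QuantumFields.BalabanUV.Beta.GAN24.UnitLatticeDecayAlgebra (entryDecay_mul entryDecay_smul)
open Summit.QuantumFields.BalabanUV.Beta.GAN24.EffectiveFormDecay (entryDecay_of_le_rate)

/-! ## §1 The step form; linear structure; symmetries -/

section Linear

variable {n : Type*} [Fintype n] [DecidableEq n] {dist : n → n → ℝ}

omit [Fintype n] [DecidableEq n] in
/-- (SR) IS (UD) OF THE STEPS: `TwoLevelDecayRate dist c B′ δ θ ↔ ∀ k, EntryDecay dist (c_{k+1} − c_k) (B′θ^k) δ` (definitional). [folklore] -/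
theorem twoLevelDecayRate_iff_step {c : ℕ → Matrix n n ℂ} {B δ θ : ℝ} :
    TwoLevelDecayRate dist c B δ θ ↔ ∀ k, EntryDecay dist (c (k + 1) - c k) (B * θ ^ k) δ := Iff.rfl

omit [Fintype n] [DecidableEq n] in
/-- sums of decaying kernels decay (constants add). [folklore] -/
theorem entryDecay_add {M N : Matrix n n ℂ} {B B' δ : ℝ} (hM : EntryDecay dist M B δ) (hN : EntryDecay dist N B' δ) :
    EntryDecay dist (M + N) (B + B') δ := by
  intro x y
  rw [Matrix.add_apply, add_mul]
  exact (norm_add_le _ _).trans (add_le_add (hM x y) (hN x y))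

omit [Fintype n] [DecidableEq n] in
/-- negatives. [folklore] -/
theorem entryDecay_neg {M : Matrix n n ℂ} {B δ : ℝ} (hM : EntryDecay dist M B δ) : EntryDecay dist (-M) B δ := by
  intro x y; rw [Matrix.neg_apply, norm_neg]; exact hM x y

omit [Fintype n] [DecidableEq n] in
/-- transposes (`dist` symmetric). [folklore] -/
theorem entryDecay_transpose (hsymm : ∀ x y, dist x y = dist y x) {M : Matrix n n ℂ} {B δ : ℝ} (hM : EntryDecay dist M B δ) :
    EntryDecay dist Mᵀ B δ := by
  intro x y; rw [Matrix.transpose_apply, hsymm]; exact hM y x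

omit [Fintype n] [DecidableEq n] in
/-- adjoints (`dist` symmetric). [folklore] -/
theorem entryDecay_conjTranspose (hsymm : ∀ x y, dist x y = dist y x) {M : Matrix n n ℂ} {B δ : ℝ} (hM : EntryDecay dist M B δ) :
    EntryDecay dist Mᴴ B δ := by
  intro x y; rw [Matrix.conjTranspose_apply, norm_star, hsymm]; exact hM y x

omit [Fintype n] [DecidableEq n] in
/-- the constant of a two-level rate is `≥ 0` (read at `k = 0`, any entry). [folklore] -/
theorem twoLevelDecayRate_const_nonneg [Nonempty n] {c : ℕ → Matrix n n ℂ} {B δ θ : ℝ} (h : TwoLevelDecayRate dist c B δ θ) : 0 ≤ B := by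
  obtain ⟨x⟩ := ‹Nonempty n›
  have := (norm_nonneg _).trans (h 0 x x)
  rw [pow_zero, mul_one] at this
  exact nonneg_of_mul_nonneg_left this (Real.exp_pos _)

omit [Fintype n] [DecidableEq n] in
/-- (SR) under sums. [folklore] -/
theorem twoLevelDecayRate_add {c c' : ℕ → Matrix n n ℂ} {B B' δ θ : ℝ} (hc : TwoLevelDecayRate dist c B δ θ) (hc' : TwoLevelDecayRate dist c' B' δ θ) :
    TwoLevelDecayRate dist (fun k => c k + c' k) (B + B') δ θ := by
  intro k
  have e : (c (k + 1) + c' (k + 1)) - (c k + c' k) = (c (k + 1) - c k) + (c' (k + 1) - c' k) := by abel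
  rw [e, add_mul]
  exact entryDecay_add (hc k) (hc' k)

omit [Fintype n] [DecidableEq n] in
/-- (SR) under negation. [folklore] -/
theorem twoLevelDecayRate_neg {c : ℕ → Matrix n n ℂ} {B δ θ : ℝ} (hc : TwoLevelDecayRate dist c B δ θ) :
    TwoLevelDecayRate dist (fun k => -c k) B δ θ := by
  intro k
  have e : -c (k + 1) - -c k = -(c (k + 1) - c k) := by abel
  rw [e]
  exact entryDecay_neg (hc k)

omit [Fintype n] [DecidableEq n] in
/-- (SR) under differences. [folklore] -/
theorem twoLevelDecayRate_sub {c c' : ℕ → Matrix n n ℂ} {B B' δ θ : ℝ} (hc : TwoLevelDecayRate dist c B δ θ) (hc' : TwoLevelDecayRate dist c' B' δ θ) :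
    TwoLevelDecayRate dist (fun k => c k - c' k) (B + B') δ θ := by
  have h := twoLevelDecayRate_add hc (twoLevelDecayRate_neg hc')
  simpa only [sub_eq_add_neg] using h

omit [Fintype n] [DecidableEq n] in
/-- (SR) under a fixed scalar. [folklore] -/
theorem twoLevelDecayRate_smul {c : ℕ → Matrix n n ℂ} {B δ θ : ℝ} (hc : TwoLevelDecayRate dist c B δ θ) (a : ℂ) :
    TwoLevelDecayRate dist (fun k => a • c k) (‖a‖ * B) δ θ := by
  intro k
  rw [← smul_sub, mul_assoc]
  exact entryDecay_smul (hc k) a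

omit [Fintype n] [DecidableEq n] in
/-- a LEVEL-INDEPENDENT kernel (a vertex stencil, the identity, `a·1`) has (SR) with constant `0`. [folklore] -/
theorem twoLevelDecayRate_const (X : Matrix n n ℂ) (δ θ : ℝ) : TwoLevelDecayRate dist (fun _ => X) 0 δ θ := by
  intro k x y; simp

omit [Fintype n] [DecidableEq n] in
/-- monotonicity of (SR) in the constant (`θ ≥ 0`). [folklore] -/
theorem twoLevelDecayRate_mono {c : ℕ → Matrix n n ℂ} {B B' δ θ : ℝ} (hc : TwoLevelDecayRate dist c B δ θ) (hB : B ≤ B') (hθ : 0 ≤ θ) :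
    TwoLevelDecayRate dist c B' δ θ := fun k x y =>
  (hc k x y).trans (mul_le_mul_of_nonneg_right (mul_le_mul_of_nonneg_right hB (pow_nonneg hθ k)) (Real.exp_pos _).le)

omit [Fintype n] [DecidableEq n] in
/-- monotonicity of (SR) in the rate: rate `δ` gives every rate `δ′ ≤ δ` (`dist ≥ 0`, `B ≥ 0`, `θ ≥ 0`). [folklore] -/
theorem twoLevelDecayRate_of_le_rate (hd0 : ∀ x y, 0 ≤ dist x y) {c : ℕ → Matrix n n ℂ} {B δ δ' θ : ℝ} (hc : TwoLevelDecayRate dist c B δ θ)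
    (hB : 0 ≤ B) (hθ : 0 ≤ θ) (hδ : δ' ≤ δ) : TwoLevelDecayRate dist c B δ' θ := fun k =>
  entryDecay_of_le_rate hd0 (hc k) (mul_nonneg hB (pow_nonneg hθ k)) hδ

omit [Fintype n] [DecidableEq n] in
/-- (SR) under transpose (`dist` symmetric). [folklore] -/
theorem twoLevelDecayRate_transpose (hsymm : ∀ x y, dist x y = dist y x) {c : ℕ → Matrix n n ℂ} {B δ θ : ℝ} (hc : TwoLevelDecayRate dist c B δ θ) :
    TwoLevelDecayRate dist (fun k => (c k)ᵀ) B δ θ := by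
  intro k; rw [← Matrix.transpose_sub]; exact entryDecay_transpose hsymm (hc k)

omit [Fintype n] [DecidableEq n] in
/-- (SR) under adjoints (`dist` symmetric). [folklore] -/
theorem twoLevelDecayRate_conjTranspose (hsymm : ∀ x y, dist x y = dist y x) {c : ℕ → Matrix n n ℂ} {B δ θ : ℝ} (hc : TwoLevelDecayRate dist c B δ θ) :
    TwoLevelDecayRate dist (fun k => (c k)ᴴ) B δ θ := by
  intro k; rw [← Matrix.conjTranspose_sub]; exact entryDecay_conjTranspose hsymm (hc k)

omit [Fintype n] [DecidableEq n] in
/-- **(SR) + decay of the base ⟹ (UD)**: `EntryDecay (c 0) B₀ δ`, `TwoLevelDecayRate c B′ δ θ`, `0 ≤ θ < 1` ⟹ every `c k` decays with `B₀ + B′∕(1−θ)` (telescoping, geometric sum). [folklore] -/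
theorem entryDecay_of_twoLevelDecayRate {c : ℕ → Matrix n n ℂ} {B₀ B δ θ : ℝ} (h0 : EntryDecay dist (c 0) B₀ δ) (hc : TwoLevelDecayRate dist c B δ θ)
    (hB : 0 ≤ B) (hθ0 : 0 ≤ θ) (hθ1 : θ < 1) (k : ℕ) : EntryDecay dist (c k) (B₀ + B / (1 - θ)) δ := by
  -- by induction: `c k` decays with `B₀ + B·Σ_{j<k} θ^j ≤ B₀ + B/(1−θ)`
  have hgeom : ∀ k, ∑ j ∈ Finset.range k, θ ^ j ≤ (1 - θ)⁻¹ := fun k => by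
    have h := geom_sum_Ico_le_of_lt_one (m := 0) (n := k) hθ0 hθ1
    rwa [pow_zero, ← Finset.range_eq_Ico, one_div] at h
  have key : ∀ k, EntryDecay dist (c k) (B₀ + B * ∑ j ∈ Finset.range k, θ ^ j) δ := by
    intro k
    induction k with
    | zero => simpa using h0
    | succ k ih =>
      have e : c (k + 1) = (c (k + 1) - c k) + c k := by abel
      have h := entryDecay_add (hc k) ih
      rw [← e] at h
      refine fun x y => (h x y).trans (le_of_eq ?_)
      rw [Finset.sum_range_succ]; ring
  intro x y
  refine (key k x y).trans (mul_le_mul_of_nonneg_right ?_ (Real.exp_pos _).le)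
  rw [div_eq_mul_inv]
  exact add_le_add le_rfl (mul_le_mul_of_nonneg_left (hgeom k) hB)

end Linear

/-! ## §2 Limits: (SR) gives the limit kernel with King's limit shape -/

section Limits

/-- a scalar sequence with geometric steps `‖u_{k+1} − u_k‖ ≤ Cθ^k`, `θ < 1`, converges, with `‖u_k − u_∞‖ ≤ Cθ^k∕(1−θ)` (Mathlib's `cauchySeq_of_le_geometric` +
`dist_le_of_le_geometric_of_tendsto`, packaged). [folklore] -/
theorem exists_limit_of_geometric_step {u : ℕ → ℂ} {C θ : ℝ} (hθ1 : θ < 1) (h : ∀ k, ‖u (k + 1) - u k‖ ≤ C * θ ^ k) :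
    ∃ v : ℂ, Tendsto u atTop (𝓝 v) ∧ ∀ k, ‖u k - v‖ ≤ C * θ ^ k / (1 - θ) := by
  have hu : ∀ k, dist (u k) (u (k + 1)) ≤ C * θ ^ k := fun k => by rw [dist_comm, dist_eq_norm]; exact h k
  obtain ⟨v, hv⟩ := cauchySeq_tendsto_of_complete (cauchySeq_of_le_geometric θ C hθ1 hu)
  exact ⟨v, hv, fun k => by rw [← dist_eq_norm]; exact dist_le_of_le_geometric_of_tendsto θ C hθ1 hu hv k⟩

variable {n : Type*} [Fintype n] [DecidableEq n] {dist : n → n → ℝ}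

omit [Fintype n] [DecidableEq n] in
/-- **`exists_limit_of_twoLevelDecayRate` — (PR′) ⟹ (PR) AT THE MATRIX LEVEL** [folklore]: a tower with `TwoLevelDecayRate dist c B′ δ θ`, `0 ≤ θ < 1`, converges (entrywise, hence in
`Matrix n n ℂ`) to a limit `c_∞` with King's limit shape `‖(c_k − c_∞)(x,y)‖ ≤ (B′∕(1−θ))·θ^k·e^{−δ·dist(x,y)}` (each entry has geometric steps `B′e^{−δ·dist}·θ^k`). -/
theorem exists_limit_of_twoLevelDecayRate {c : ℕ → Matrix n n ℂ} {B δ θ : ℝ} (hc : TwoLevelDecayRate dist c B δ θ) (hθ1 : θ < 1) :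
    ∃ clim : Matrix n n ℂ, Tendsto c atTop (𝓝 clim) ∧ DecayRate dist c clim (B / (1 - θ)) δ θ := by
  have hxy : ∀ x y, ∃ v : ℂ, Tendsto (fun k => c k x y) atTop (𝓝 v) ∧ ∀ k, ‖c k x y - v‖ ≤ (B * Real.exp (-(δ * dist x y))) * θ ^ k / (1 - θ) := by
    intro x y
    refine exists_limit_of_geometric_step hθ1 fun k => ?_
    have h := hc k x y
    rw [Matrix.sub_apply] at h
    exact h.trans (le_of_eq (by ring))
  choose v hv using hxy
  refine ⟨Matrix.of fun x y => v x y, ?_, fun k x y => ?_⟩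
  · exact tendsto_pi_nhds.mpr fun x => tendsto_pi_nhds.mpr fun y => (hv x y).1
  · rw [Matrix.sub_apply, Matrix.of_apply]
    exact ((hv x y).2 k).trans (le_of_eq (by ring))

end Limits

/-! ## §3 Products: an internal vertex summed over the lattice -/

section Products

/-- **`norm_mul_apply_le_of_decay` — PRODUCTS OF RECTANGULAR DECAYING KERNELS** [folklore]: `M : l × m`, `N : m × p` with `‖M x z‖ ≤ B₁e^{−κ·d₁(x,z)}`, `‖N z y‖ ≤ B₂e^{−κ·d₂(z,y)}`,
«distances» with the mixed triangle inequality `d(x,y) ≤ d₁(x,z) + d₂(z,y)`, `d₂ ≥ 0`, `κ ≥ 0`, and the letter `Σ_z e^{−(κ∕2)d₁(x,z)} ≤ S` ⟹ `‖(MN)(x,y)‖ ≤ B₁B₂S·e^{−(κ∕2)d(x,y)}`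
(PART 127's `entryDecay_mul` is the square case `l = m = p`, one distance). -/
theorem norm_mul_apply_le_of_decay {l m p : Type*} [Fintype m] {d₁ : l → m → ℝ} {d₂ : m → p → ℝ} {d : l → p → ℝ}
    (htri : ∀ x z y, d x y ≤ d₁ x z + d₂ z y) (hd₂ : ∀ z y, 0 ≤ d₂ z y) {κ S B₁ B₂ : ℝ} (hκ : 0 ≤ κ)
    (hS : ∀ x, ∑ z, Real.exp (-(κ / 2 * d₁ x z)) ≤ S) {M : Matrix l m ℂ} {N : Matrix m p ℂ}
    (hM : ∀ x z, ‖M x z‖ ≤ B₁ * Real.exp (-(κ * d₁ x z))) (hN : ∀ z y, ‖N z y‖ ≤ B₂ * Real.exp (-(κ * d₂ z y))) (hB₁ : 0 ≤ B₁) (hB₂ : 0 ≤ B₂)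
    (x : l) (y : p) : ‖(M * N) x y‖ ≤ B₁ * B₂ * S * Real.exp (-(κ / 2 * d x y)) := by
  rw [Matrix.mul_apply]
  calc ‖∑ z, M x z * N z y‖ ≤ ∑ z, ‖M x z * N z y‖ := norm_sum_le _ _
    _ ≤ ∑ z, (B₁ * B₂ * Real.exp (-(κ / 2 * d x y))) * Real.exp (-(κ / 2 * d₁ x z)) := by
        refine Finset.sum_le_sum fun z _ => ?_
        rw [norm_mul]
        have hexp : Real.exp (-(κ * d₁ x z)) * Real.exp (-(κ * d₂ z y)) ≤ Real.exp (-(κ / 2 * d x y)) * Real.exp (-(κ / 2 * d₁ x z)) := by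
          rw [← Real.exp_add, ← Real.exp_add]
          refine Real.exp_le_exp.mpr ?_
          have := htri x z y
          have := hd₂ z y
          have : κ / 2 * d x y ≤ κ / 2 * d₁ x z + κ / 2 * d₂ z y := by nlinarith
          nlinarith
        calc ‖M x z‖ * ‖N z y‖ ≤ (B₁ * Real.exp (-(κ * d₁ x z))) * (B₂ * Real.exp (-(κ * d₂ z y))) :=
              mul_le_mul (hM x z) (hN z y) (norm_nonneg _) (mul_nonneg hB₁ (Real.exp_pos _).le)
          _ = B₁ * B₂ * (Real.exp (-(κ * d₁ x z)) * Real.exp (-(κ * d₂ z y))) := by ring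
          _ ≤ B₁ * B₂ * (Real.exp (-(κ / 2 * d x y)) * Real.exp (-(κ / 2 * d₁ x z))) := mul_le_mul_of_nonneg_left hexp (mul_nonneg hB₁ hB₂)
          _ = _ := by ring
    _ = (B₁ * B₂ * Real.exp (-(κ / 2 * d x y))) * ∑ z, Real.exp (-(κ / 2 * d₁ x z)) := by rw [Finset.mul_sum]
    _ ≤ (B₁ * B₂ * Real.exp (-(κ / 2 * d x y))) * S := mul_le_mul_of_nonneg_left (hS x) (by positivity)
    _ = _ := by ring

variable {n : Type*} [Fintype n] [DecidableEq n] {dist : n → n → ℝ}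

omit [DecidableEq n] in
/-- **`twoLevelDecayRate_mul` — (SR) UNDER PRODUCTS (AN INTERNAL VERTEX)** [folklore]: `dist ≥ 0` with the triangle inequality, `κ ≥ 0`, `θ ≥ 0`, the letter `Σ_z e^{−(κ∕2)dist(x,z)} ≤ S`;
(UD) `(B₁, κ)` ∕ `(B₂, κ)` and (SR) `(B₁′, κ, θ)` ∕ `(B₂′, κ, θ)` for `c`, `c′` ⟹ `TwoLevelDecayRate dist (c_k·c′_k) ((B₁′B₂ + B₁B₂′)·S) (κ∕2) θ`
(`c_{k+1}c′_{k+1} − c_kc′_k = (c_{k+1} − c_k)c′_{k+1} + c_k(c′_{k+1} − c′_k)`, two applications of PART 127). -/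
theorem twoLevelDecayRate_mul (hd0 : ∀ x y, 0 ≤ dist x y) (htri : ∀ x y z, dist x y ≤ dist x z + dist z y) {κ S B₁ B₂ B₁' B₂' θ : ℝ} (hκ : 0 ≤ κ)
    (hS : ∀ x, ∑ z, Real.exp (-(κ / 2 * dist x z)) ≤ S) {c c' : ℕ → Matrix n n ℂ}
    (hc : ∀ k, EntryDecay dist (c k) B₁ κ) (hc' : ∀ k, EntryDecay dist (c' k) B₂ κ)
    (hr : TwoLevelDecayRate dist c B₁' κ θ) (hr' : TwoLevelDecayRate dist c' B₂' κ θ) :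
    TwoLevelDecayRate dist (fun k => c k * c' k) ((B₁' * B₂ + B₁ * B₂') * S) (κ / 2) θ := by
  intro k
  have e : c (k + 1) * c' (k + 1) - c k * c' k = (c (k + 1) - c k) * c' (k + 1) + c k * (c' (k + 1) - c' k) := by
    rw [sub_mul, Matrix.mul_sub]; abel
  have h1 : EntryDecay dist ((c (k + 1) - c k) * c' (k + 1)) (B₁' * θ ^ k * B₂ * S) (κ / 2) := entryDecay_mul hd0 htri hκ hS (hr k) (hc' (k + 1))
  have h2 : EntryDecay dist (c k * (c' (k + 1) - c' k)) (B₁ * (B₂' * θ ^ k) * S) (κ / 2) := entryDecay_mul hd0 htri hκ hS (hc k) (hr' k)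
  have h := entryDecay_add h1 h2
  rw [e]
  intro x y
  exact (h x y).trans (le_of_eq (by ring))

omit [DecidableEq n] in
/-- (UD) under products, tower form (PART 127 per level): `(B₁B₂S, κ∕2)`. [folklore] -/
theorem entryDecay_mul_tower (hd0 : ∀ x y, 0 ≤ dist x y) (htri : ∀ x y z, dist x y ≤ dist x z + dist z y) {κ S B₁ B₂ : ℝ} (hκ : 0 ≤ κ)
    (hS : ∀ x, ∑ z, Real.exp (-(κ / 2 * dist x z)) ≤ S) {c c' : ℕ → Matrix n n ℂ}
    (hc : ∀ k, EntryDecay dist (c k) B₁ κ) (hc' : ∀ k, EntryDecay dist (c' k) B₂ κ) (k : ℕ) :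
    EntryDecay dist (c k * c' k) (B₁ * B₂ * S) (κ / 2) := entryDecay_mul hd0 htri hκ hS (hc k) (hc' k)

end Products

/-! ## §4 Hadamard products: parallel lines between the same two vertices -/

section Hadamard

variable {n : Type*} [Fintype n] [DecidableEq n] {dist : n → n → ℝ}

omit [Fintype n] [DecidableEq n] in
/-- **`entryDecay_hadamard` — PARALLEL LINES MULTIPLY, DECAY RATES ADD** [folklore]: `EntryDecay M B₁ δ₁`, `EntryDecay N B₂ δ₂` ⟹ `EntryDecay (M ⊙ N) (B₁B₂) (δ₁ + δ₂)`; no letter. -/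
theorem entryDecay_hadamard {M N : Matrix n n ℂ} {B₁ B₂ δ₁ δ₂ : ℝ} (hM : EntryDecay dist M B₁ δ₁) (hN : EntryDecay dist N B₂ δ₂) :
    EntryDecay dist (M ⊙ N) (B₁ * B₂) (δ₁ + δ₂) := by
  intro x y
  have h0 : 0 ≤ B₁ * Real.exp (-(δ₁ * dist x y)) := (norm_nonneg _).trans (hM x y)
  rw [Matrix.hadamard_apply, norm_mul]
  calc ‖M x y‖ * ‖N x y‖ ≤ (B₁ * Real.exp (-(δ₁ * dist x y))) * (B₂ * Real.exp (-(δ₂ * dist x y))) := mul_le_mul (hM x y) (hN x y) (norm_nonneg _) h0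
    _ = B₁ * B₂ * Real.exp (-((δ₁ + δ₂) * dist x y)) := by
        rw [add_mul, neg_add, Real.exp_add]; ring

omit [Fintype n] [DecidableEq n] in
/-- **`twoLevelDecayRate_hadamard` — (SR) UNDER HADAMARD PRODUCTS** [folklore]: (UD) `(B₁, δ₁)` ∕ `(B₂, δ₂)` and (SR) `(B₁′, δ₁, θ)` ∕ `(B₂′, δ₂, θ)` ⟹
`TwoLevelDecayRate dist (c_k ⊙ c′_k) (B₁′B₂ + B₁B₂′) (δ₁ + δ₂) θ` (`c_{k+1}⊙c′_{k+1} − c_k⊙c′_k = (c_{k+1} − c_k)⊙c′_{k+1} + c_k⊙(c′_{k+1} − c′_k)`); no letter. -/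
theorem twoLevelDecayRate_hadamard {c c' : ℕ → Matrix n n ℂ} {B₁ B₂ B₁' B₂' δ₁ δ₂ θ : ℝ}
    (hc : ∀ k, EntryDecay dist (c k) B₁ δ₁) (hc' : ∀ k, EntryDecay dist (c' k) B₂ δ₂)
    (hr : TwoLevelDecayRate dist c B₁' δ₁ θ) (hr' : TwoLevelDecayRate dist c' B₂' δ₂ θ) :
    TwoLevelDecayRate dist (fun k => c k ⊙ c' k) (B₁' * B₂ + B₁ * B₂') (δ₁ + δ₂) θ := by
  intro k
  have e : c (k + 1) ⊙ c' (k + 1) - c k ⊙ c' k = (c (k + 1) - c k) ⊙ c' (k + 1) + c k ⊙ (c' (k + 1) - c' k) := by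
    ext x y; simp only [Matrix.sub_apply, Matrix.add_apply, Matrix.hadamard_apply]; ring
  have h := entryDecay_add (entryDecay_hadamard (hr k) (hc' (k + 1))) (entryDecay_hadamard (hc k) (hr' k))
  rw [e]
  intro x y
  exact (h x y).trans (le_of_eq (by ring))

end Hadamard

/-! ## §5 Kronecker products: two lines as one kernel on the pair lattice (sum distance) -/

section Kronecker

variable {n m : Type*} [Fintype n] [DecidableEq n] [Fintype m] [DecidableEq m] {dn : n → n → ℝ} {dm : m → m → ℝ}

omit [Fintype n] [DecidableEq n] [Fintype m] [DecidableEq m] in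
/-- **`entryDecay_kronecker`** [folklore]: `EntryDecay dn M B₁ δ`, `EntryDecay dm N B₂ δ` ⟹ on the pair lattice `n × m` with the SUM distance `d((x,u),(y,v)) = dn(x,y) + dm(u,v)`:
`EntryDecay (M ⊗ₖ N) (B₁B₂) δ`. -/
theorem entryDecay_kronecker {M : Matrix n n ℂ} {N : Matrix m m ℂ} {B₁ B₂ δ : ℝ} (hM : EntryDecay dn M B₁ δ) (hN : EntryDecay dm N B₂ δ) :
    EntryDecay (fun p q : n × m => dn p.1 q.1 + dm p.2 q.2) (M ⊗ₖ N) (B₁ * B₂) δ := by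
  rintro ⟨x, u⟩ ⟨y, v⟩
  have h0 : 0 ≤ B₁ * Real.exp (-(δ * dn x y)) := (norm_nonneg _).trans (hM x y)
  rw [Matrix.kroneckerMap_apply, norm_mul]
  calc ‖M x y‖ * ‖N u v‖ ≤ (B₁ * Real.exp (-(δ * dn x y))) * (B₂ * Real.exp (-(δ * dm u v))) := mul_le_mul (hM x y) (hN u v) (norm_nonneg _) h0
    _ = B₁ * B₂ * Real.exp (-(δ * (dn x y + dm u v))) := by rw [mul_add, neg_add, Real.exp_add]; ring

omit [Fintype n] [DecidableEq n] [Fintype m] [DecidableEq m] in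
/-- **`twoLevelDecayRate_kronecker`** [folklore]: (UD) `(B₁, δ)` ∕ `(B₂, δ)` and (SR) `(B₁′, δ, θ)` ∕ `(B₂′, δ, θ)` ⟹ `TwoLevelDecayRate d₊ (c_k ⊗ₖ c′_k) (B₁′B₂ + B₁B₂′) δ θ` on the pair lattice. -/
theorem twoLevelDecayRate_kronecker {c : ℕ → Matrix n n ℂ} {c' : ℕ → Matrix m m ℂ} {B₁ B₂ B₁' B₂' δ θ : ℝ}
    (hc : ∀ k, EntryDecay dn (c k) B₁ δ) (hc' : ∀ k, EntryDecay dm (c' k) B₂ δ)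
    (hr : TwoLevelDecayRate dn c B₁' δ θ) (hr' : TwoLevelDecayRate dm c' B₂' δ θ) :
    TwoLevelDecayRate (fun p q : n × m => dn p.1 q.1 + dm p.2 q.2) (fun k => c k ⊗ₖ c' k) (B₁' * B₂ + B₁ * B₂') δ θ := by
  intro k
  have e : c (k + 1) ⊗ₖ c' (k + 1) - c k ⊗ₖ c' k = (c (k + 1) - c k) ⊗ₖ c' (k + 1) + c k ⊗ₖ (c' (k + 1) - c' k) := by
    ext ⟨x, u⟩ ⟨y, v⟩; simp only [Matrix.sub_apply, Matrix.add_apply, Matrix.kroneckerMap_apply]; ring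
  have h := entryDecay_add (entryDecay_kronecker (hr k) (hc' (k + 1))) (entryDecay_kronecker (hc k) (hr' k))
  rw [e]
  intro p q
  exact (h p q).trans (le_of_eq (by ring))

omit [DecidableEq n] [DecidableEq m] in
/-- the pair letter: `Σ_{(y,v)} e^{−c(dn(x,y) + dm(u,v))} = (Σ_y e^{−c·dn(x,y)})(Σ_v e^{−c·dm(u,v)}) ≤ S·S′`. [folklore] -/
theorem sum_exp_pairDist_le {c S S' : ℝ} (hS : ∀ x, ∑ y, Real.exp (-(c * dn x y)) ≤ S) (hS' : ∀ u, ∑ v, Real.exp (-(c * dm u v)) ≤ S') (p : n × m) :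
    ∑ q : n × m, Real.exp (-(c * (dn p.1 q.1 + dm p.2 q.2))) ≤ S * S' := by
  have hS0 : 0 ≤ S := le_trans (Finset.sum_nonneg fun y _ => (Real.exp_pos _).le) (hS p.1)
  rw [Fintype.sum_prod_type]
  have e : ∀ y : n, ∑ v : m, Real.exp (-(c * (dn p.1 y + dm p.2 v))) = Real.exp (-(c * dn p.1 y)) * ∑ v, Real.exp (-(c * dm p.2 v)) := by
    intro y; rw [Finset.mul_sum]; refine Finset.sum_congr rfl fun v _ => ?_; rw [← Real.exp_add]; congr 1; ring
  simp_rw [e]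
  calc ∑ y, Real.exp (-(c * dn p.1 y)) * ∑ v, Real.exp (-(c * dm p.2 v)) ≤ ∑ y, Real.exp (-(c * dn p.1 y)) * S' :=
        Finset.sum_le_sum fun y _ => mul_le_mul_of_nonneg_left (hS' p.2) (Real.exp_pos _).le
    _ = (∑ y, Real.exp (-(c * dn p.1 y))) * S' := by rw [Finset.sum_mul]
    _ ≤ S * S' := mul_le_mul_of_nonneg_right (hS p.1) (le_trans (Finset.sum_nonneg fun v _ => (Real.exp_pos _).le) (hS' p.2))

omit [Fintype n] [DecidableEq n] [Fintype m] [DecidableEq m] in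
/-- the pair distance inherits nonnegativity, the zero diagonal, symmetry and the triangle inequality. [folklore] -/
theorem pairDist_laws (hn0 : ∀ x y, 0 ≤ dn x y) (hm0 : ∀ u v, 0 ≤ dm u v) (hns : ∀ x, dn x x = 0) (hms : ∀ u, dm u u = 0)
    (hnc : ∀ x y, dn x y = dn y x) (hmc : ∀ u v, dm u v = dm v u)
    (hnt : ∀ x y z, dn x y ≤ dn x z + dn z y) (hmt : ∀ u v w, dm u v ≤ dm u w + dm w v) :
    (∀ p q : n × m, 0 ≤ dn p.1 q.1 + dm p.2 q.2) ∧ (∀ p : n × m, dn p.1 p.1 + dm p.2 p.2 = 0) ∧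
      (∀ p q : n × m, dn p.1 q.1 + dm p.2 q.2 = dn q.1 p.1 + dm q.2 p.2) ∧
      (∀ p q r : n × m, dn p.1 q.1 + dm p.2 q.2 ≤ (dn p.1 r.1 + dm p.2 r.2) + (dn r.1 q.1 + dm r.2 q.2)) :=
  ⟨fun p q => add_nonneg (hn0 _ _) (hm0 _ _), fun p => by rw [hns, hms, add_zero], fun p q => by rw [hnc, hmc],
    fun p q r => by have := hnt p.1 q.1 r.1; have := hmt p.2 q.2 r.2; linarith⟩

end Kronecker

end Summit.QuantumFields.BalabanUV.Beta.GAN24.DiagramDecayAlgebra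

end
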